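import Summits.BirchSwinnertonDyer.BirchSwinnertonDyer.Theorems.Rank2ObservatoryThreeIsoRow
import Summits.BirchSwinnertonDyer.BirchSwinnertonDyer.Theorems.Rank2ObservatoryThreeIsoKField
import Summits.BirchSwinnertonDyer.BirchSwinnertonDyer.Theorems.Rank2ObservatoryThreeIsoNormCut
import Summits.BirchSwinnertonDyer.BirchSwinnertonDyer.Theorems.Rank2ObservatoryThreeIsoPrimes
import Summits.BirchSwinnertonDyer.BirchSwinnertonDyer.Theorems.Rank2ObservatoryThreeIsoInert
import Summits.BirchSwinnertonDyer.BirchSwinnertonDyer.Theorems.Rank2ObservatoryThreeIsoEhatClass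
import Summits.BirchSwinnertonDyer.BirchSwinnertonDyer.Theorems.Rank2ObservatoryThreeIsoRowKit
import Summits.BirchSwinnertonDyer.BirchSwinnertonDyer.Theorems.Rank2ObservatoryThreeIsoIndexLog
import Summits.BirchSwinnertonDyer.BirchSwinnertonDyer.Theorems.Rank2ObservatoryThreeIsoCertE
import Summits.BirchSwinnertonDyer.BirchSwinnertonDyer.Theorems.Rank2ObservatoryThreeIsoCertK
import Summits.ABC.ABC.Theorems.KenkuLevelThirtyFiveMWReduction
import Mathlib.Tactic.NormNum.Prime
import HarnessLib

/-!
# `KenkuPrintedLevels` (stmt-ABC-18224) (ii), level `35`: `rank_ℤ 35a1(ℚ) = 0` by `3`-isogeny descent,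
# hence `35a1(ℚ) = {O, (0, ±28)}` (`hMW`) and "no cyclic rational `35`-isogeny" with NO input left

`Summits/ABC/ABC/Theorems/KenkuLevelThirtyFiveRankZero.lean` — unit `abc-inputs-pr-4` (KEY KENKU35-HMW,
row I-07/35b, deliverable S2; PROOFS ONLY: 0 definitions, 0 named facts; `--supports stmt-ABC-18224 --as
helper`). The descent statement of `KenkuLevelThirtyFiveMWReduction.lean`,
`(threeTorsionModel (4 : ℚ) 28).mordellWeilRank = 0` (Cremona `35a1`: `r = 0`), is PROVED as one more
row of the tree's per-curve `3`-isogeny-descent kit (BSD rank-2 observatory, KERNEL-3ISO, kits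
`Summit.BirchSwinnertonDyer.BirchSwinnertonDyer.Rank2Observatory.ThreeIso.*`; Cohen GTM 239 §8.4,
Cohen–Pazuki 2009) on the model `E_{m,s} : y² = x³ + (mx + s)²`, `(m, s) = (4, 28)`
(`Δ = -2¹²·5³·7³`, `4m³ - 27s = -500`, `81s - 12m³ = 1500`):

* E-side (`ℚ`): `K(S,3)`-classes supported on `primeFactors (2s) = {2, 7}` (`3²` classes); 3 local-kill
  certificates at level `2³` — the `2`-minimised torsors `X³ + 2Y³ + 28Z³ - 8XYZ`,
  `49X³ + 2Y³ + 196Z³ - 56XYZ`, `2401X³ + 2Y³ + 1372Z³ - 392XYZ` of the classes `2`, `2·7`, `2·7²`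
  have no primitive zero modulo `8` (and the inverse classes `2²`, `2²7²`, `2²7` die with them) — leave
  `#Im κ ≤ 3 < 3²` (the surviving classes `1, 7, 7²` are `κ(O), κ(∓T)`): `E` has good reduction at `2`, so
  the local image at `2` is trivial and `v₂` of a Selmer class is `≡ 0 (mod 3)`;
* Ê-side (`K = ℚ(ζ₃)`, `η = ζ₃`, `θ₀ = 1 + 2η`): `2θ₀(81s - 12m³) = 2θ₀·1500 = -θ₀³·2³·5³` over the prime
  family `P = {θ₀, 2, 5}` (`2, 5` inert), no split primes, so the support law with norm cut
  (`exists_descentEhat_class`) leaves the `3` classes `[ζ^j]`, of which ONE certificate at level `7¹` (the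
  torsor `r³ - 3r²t - 9rt² + 3t³ + 24r²v + 72t²v + 3000v³` of `[ζ]` has no primitive zero modulo `7`:
  `E` is split multiplicative at `7` with `c₇(E) = 3`, `c₇(Ê) = 1`, so the `φ`-local image at `7` is
  trivial while `ζ₃` is not a cube in `ℚ₇`) leaves `#Im κ' ≤ 1 < 3¹`;
* count (log rule `ThreeIso.mordellWeilRank_le_of_images_log`): `3^(r+1) ≤ 3¹ · 3⁰`, so `r = 0`.

Results: `Curve35a1Descent.model_mordellWeilRank_le_zero`, `mordellWeilRank_35a1_eq_zero`; with
`KenkuLevelThirtyFiveMWReduction.lean` (rank `0` + Mordell–Weil + reduction mod `3`, `11`):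
**`mordellWeil_35a1 : ∀ X Y : ℚ, Y² = X³ + (4X + 28)² → X = 0`** — pr-1's displayed binder `hMW` of
level `35`, now a THEOREM — and **`isCyclic_degree_ne_thirtyFive`**: no elliptic curve over `ℚ` admits a
cyclic `ℚ`-isogeny of degree `35`, with no displayed input left (pr-1's link ★ + this).

HONESTY. An INPUTS→UNCONDITIONAL library theorem at abc distance 0 (row I-07/35b): it makes pr-1's
conditional level-`35` line unconditional AS TYPED; the item stmt-ABC-18224 is NOT closed by this file;
abc moved by 0, A-PS by 0; NOT abc; typed ≠ proved.

References: [Cohen2007NumberTheoryI] §8.4, Prop. 8.4.8; [CohenPazuki2009] Prop. 2.2, Thm. 3.1;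
[CremonaAlgorithms1997] Table 1, `N = 35`, curve `A1` (`r = 0`, `|T| = 3`); [Kenku1982] Thm. 1.
-/

-- `Summit.ABC.ABC` is the mandated summit-side namespace (CONVENTIONS §2); the duplicate is deliberate.
set_option linter.dupNamespace false

noncomputable section

open scoped Classical

namespace Summit.ABC.ABC.Theorems

open NumberField WeierstrassCurve
open Literature.NumberTheory.EllipticCurves Literature.NumberTheory.EllipticCurves.MordellDescent
open Summit.BirchSwinnertonDyer.BirchSwinnertonDyer.Rank2Observatory.ThreeIso

namespace Curve35a1Descent

/-- The model `E_{4,28}` is elliptic: `16 s³ (4m³ - 27s) ≠ 0`. [folklore] -/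
theorem model_isElliptic : (threeTorsionModel (((4 : ℤ) : ℚ)) (((28 : ℤ) : ℚ))).IsElliptic :=
  (isElliptic_threeTorsionModel_iff _ _).mpr (by norm_num)

/-- `(E_{4,28}, E'_{4,28})` is a Vélu three-pair. [folklore] -/
theorem isVeluThreePair : IsVeluThreePair (((4 : ℤ) : ℚ)) (((28 : ℤ) : ℚ))
    (threeTorsionModel (((4 : ℤ) : ℚ)) (((28 : ℤ) : ℚ)))
    (threeIsogenyCodomain (((4 : ℤ) : ℚ)) (((28 : ℤ) : ℚ))) :=
  isVeluThreePair_threeTorsionModel (by rw [Δ_threeTorsionModel]; norm_num)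

/-! ### Ê-side (`K = ℚ(ζ₃)`): the prime family `P = {θ₀, 2, 5}` in integer coordinates

`P` = `1 + 2η`, `2 + 0η`, `5 + 0η`; norm forms `3`, `4`, `25`; no split primes. -/

section Ehat

variable {K : Type*} [Field K] [NumberField K] [IsCyclotomicExtension {3} ℚ K] {ζ : K}
  (hζ : IsPrimitiveRoot ζ 3)

omit [IsCyclotomicExtension {3} ℚ K] in
/-- The factorisation `2θ₀(81s - 12m³) = 2θ₀·1500 = (-1) · θ₀^3 · 2^3 · 5^3` over `P`
(`3 = -θ₀²`). [folklore] -/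
theorem ehat_fac : 2 * (2 * hζ.toInteger + 1) * ((81 * (28 : ℤ) - 12 * (4 : ℤ) ^ 3 : ℤ) : 𝓞 K) =
    ((-1 : (𝓞 K)ˣ) : 𝓞 K) * ∏ q ∈ ({((1 : ℤ) : 𝓞 K) + (2 : ℤ) * hζ.toInteger,
      ((2 : ℤ) : 𝓞 K) + (0 : ℤ) * hζ.toInteger, ((5 : ℤ) : 𝓞 K) + (0 : ℤ) * hζ.toInteger}
        : Finset (𝓞 K)), q ^ (fun _ => 3) q := by
  rw [Finset.prod_insert (by simp +decide only [Finset.mem_insert, Finset.mem_singleton, coords_eq_iff hζ]),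
    Finset.prod_pair (by simp +decide only [ne_eq, coords_eq_iff hζ])]
  simp only [Units.val_neg, Units.val_one]
  push_cast
  linear_combination (4000 * (2 * hζ.toInteger + 1)) * toInteger_sq hζ

set_option maxHeartbeats 4000000 in
/-- **Ê-side support law** (index form for `ThreeIso.ehat_descent_mem_of_certs`, no split primes): every
`3`-descent value of an affine rational point of `Ê` over `K = ℚ(ζ₃)` is the class of `ζ^j`, `j ∈ 𝔽₃` —
`exists_descentEhat_class` on `P = {θ₀, 2, 5}` (self-conjugate); the norm cut kills every exponent.
[cite: Cohen2007NumberTheoryI, Prop. 8.4.8 (3); CohenPazuki2009, Prop. 2.2] -/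
theorem ehat_supp (σ : K ≃ₐ[ℚ] K) (hσ : σ ζ = ζ ^ 2) (X Y : ℚ)
    (hQ : (threeIsogenyCodomain (((4 : ℤ) : ℚ)) (((28 : ℤ) : ℚ))).toAffine.Nonsingular X Y) :
    ∃ w : Fin 3 × (Fin 0 → Fin 3),
      cubeClass ((Y : K) - (2 * ζ + 1) * (((((4 : ℤ) : ℚ)) : K) * ((X : K) + 4 * ((((4 : ℤ) : ℚ)) : K) ^ 2 / 3)
          + (27 * ((((28 : ℤ) : ℚ)) : K) - 4 * ((((4 : ℤ) : ℚ)) : K) ^ 3) / 9)) =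
        cubeClass (ζ ^ ((w).1 : ℕ) * ∏ ℓ : Fin 0,
          ((((((![] : Fin 0 → ℤ × ℤ) ℓ).1 : 𝓞 K) +
              (((![] : Fin 0 → ℤ × ℤ) ℓ).2 : ℤ) * hζ.toInteger : 𝓞 K) : K) ^ (((w).2 ℓ : Fin 3) : ℕ) *
            (((((![] : Fin 0 → ℤ × ℤ) ℓ).1 : 𝓞 K) +
              (((![] : Fin 0 → ℤ × ℤ) ℓ).2 : ℤ) * hζ.toInteger : 𝓞 K) : K) ^ ((3 - (((w).2 ℓ : Fin 3) : ℕ)) % 3))) := by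
  -- the primes `θ₀ = 1 + 2η ~ λ` (ramified), `2`, `5` (inert, `≡ 2 (mod 3)`); pairwise non-associated
  -- (norm forms `3, 4, 25`); each is its own conjugate up to a unit [cite: IrelandRosen1990, Prop. 9.1.4]
  obtain ⟨j, k, hj, hk, hcut, hcl⟩ := exists_descentEhat_class hζ σ hσ isVeluThreePair
    ({((1 : ℤ) : 𝓞 K) + (2 : ℤ) * hζ.toInteger, ((2 : ℤ) : 𝓞 K) + (0 : ℤ) * hζ.toInteger,
      ((5 : ℤ) : 𝓞 K) + (0 : ℤ) * hζ.toInteger} : Finset (𝓞 K))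
    (by -- the members of `P` are prime
      intro q hq
      simp only [Finset.mem_insert, Finset.mem_singleton] at hq
      rcases hq with rfl | rfl | rfl
      · have : ((1 : ℤ) : 𝓞 K) + (2 : ℤ) * hζ.toInteger = 2 * hζ.toInteger + 1 := by push_cast; ring
        rw [this]; exact prime_two_mul_toInteger_add_one hζ
      · exact prime_inert_coords hζ (q := 2) (by norm_num) (by norm_num)
      · exact prime_inert_coords hζ (q := 5) (by norm_num) (by norm_num))
    (by -- pairwise non-association
      intro q hq q' hq' hqq'
      simp only [Finset.mem_insert, Finset.mem_singleton] at hq hq'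
      rcases hq with rfl | rfl | rfl <;> rcases hq' with rfl | rfl | rfl <;>
        first
        | rfl
        | exact absurd (norm_form_eq_of_associated hζ hqq') (by decide))
    (fun q => q) (fun q hq => hq) (fun q _ => rfl)
    (by
      simp only [Finset.mem_insert, Finset.mem_singleton, forall_eq_or_imp, forall_eq]
      refine ⟨?_, ?_, ?_⟩ <;> rw [conj_coords hζ σ hσ]
      · refine (Associated.of_eq ?_).trans (Associated.refl _).neg_left; push_cast; ring
      all_goals exact Associated.of_eq (by push_cast; ring))
    (-1) _ (ehat_fac hζ) hQ
  refine ⟨(⟨j, hj⟩, ![]), ?_⟩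
  rw [hcl,
    Finset.prod_insert (by simp +decide only [Finset.mem_insert, Finset.mem_singleton, coords_eq_iff hζ]),
    Finset.prod_pair (by simp +decide only [ne_eq, coords_eq_iff hζ])]
  have hk1 : k (((1 : ℤ) : 𝓞 K) + (2 : ℤ) * hζ.toInteger) = 0 := by
    have hc := hcut (((1 : ℤ) : 𝓞 K) + (2 : ℤ) * hζ.toInteger) (by simp)
    have := hk (((1 : ℤ) : 𝓞 K) + (2 : ℤ) * hζ.toInteger); omega
  have hk2 : k (((2 : ℤ) : 𝓞 K) + (0 : ℤ) * hζ.toInteger) = 0 := by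
    have hc := hcut (((2 : ℤ) : 𝓞 K) + (0 : ℤ) * hζ.toInteger) (by simp)
    have := hk (((2 : ℤ) : 𝓞 K) + (0 : ℤ) * hζ.toInteger); omega
  have hk5 : k (((5 : ℤ) : 𝓞 K) + (0 : ℤ) * hζ.toInteger) = 0 := by
    have hc := hcut (((5 : ℤ) : 𝓞 K) + (0 : ℤ) * hζ.toInteger) (by simp)
    have := hk (((5 : ℤ) : 𝓞 K) + (0 : ℤ) * hζ.toInteger); omega
  rw [hk1, hk2, hk5, pow_zero, pow_zero, pow_zero, mul_one, mul_one, mul_one]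
  congr 1
  simp only [Finset.univ_eq_empty, Finset.prod_empty, mul_one]

end Ehat

set_option maxHeartbeats 4000000 in
/-- **`rank_ℤ E_{4,28}(ℚ) ≤ 0` by `3`-isogeny descent**, hypothesis-free: `#Im κ < 3²` (3 local-kill
certificates at `2³`), `#Im κ' < 3¹` (1 certificate at `7¹`), certificate lists checked by the kernel, so
`3^(r+1) ≤ 3¹ · 3⁰` (log rule). [cite: Cohen2007NumberTheoryI, Prop. 8.4.8]
[cite: CohenPazuki2009, Prop. 2.2, Thm. 3.1] -/
theorem model_mordellWeilRank_le_zero :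
    (threeTorsionModel (((4 : ℤ) : ℚ)) (((28 : ℤ) : ℚ))).mordellWeilRank ≤ 0 := by
  have h := isVeluThreePair
  haveI hK : IsCyclotomicExtension {3} ℚ (CyclotomicField 3 ℚ) := CyclotomicField.isCyclotomicExtension 3 ℚ
  have hζ := IsCyclotomicExtension.zeta_spec 3 ℚ (CyclotomicField 3 ℚ)
  -- B1/B3a: the Ê-side descent map over K = ℚ(ζ₃) with ker κ' ≤ φ(E(ℚ)); complex conjugation
  obtain ⟨κ', hκ'val, hκ'ker⟩ := exists_descentHom_Ehat_cyclotomic hζ h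
  obtain ⟨σ, hσ⟩ := exists_conj hζ
  -- E-side support: `primeFactors (2s) = {2, 7}`
  have hps : (2 * (28 : ℤ)).natAbs.primeFactors = Finset.univ.image (![2, 7] : Fin 2 → ℕ) := by
    rw [show (2 * (28 : ℤ)).natAbs = 2 ^ 3 * 7 by norm_num,
      Nat.primeFactors_mul (by norm_num) (by norm_num),
      Nat.primeFactors_prime_pow (by norm_num) Nat.prime_two,
      (show Nat.Prime 7 by norm_num).primeFactors]
    decide
  -- Ê-side image bound: support law + certificate list (kit CertK), validity by the kernel
  have hS' := ehat_descent_mem_of_certs hζ h κ' hκ'val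
    (![] : Fin 0 → ℤ × ℤ) (![] : Fin 0 → ℤ × ℤ) (fun ℓ => Fin.elim0 ℓ) (ehat_supp hζ σ hσ)
    ([(((1, ![]), 7, 1), (1, 1, 1, 1), (0, 1, 1), (1, Int.neg 3, Int.neg 9, 3, 24, 72, 3000))]
      : List (((Fin 3 × (Fin 0 → Fin 3)) × ℕ × ℕ) × (ℕ × ℕ × ℕ × ℕ) × (ℤ × ℤ × ℤ) ×
          (ℤ × ℤ × ℤ × ℤ × ℤ × ℤ × ℤ)))
    (by decide +kernel)
  -- log rule; E-side image bound: support law + certificate list (kit CertE)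
  refine mordellWeilRank_le_of_images_log (G' := Additive (CubeUnits (CyclotomicField 3 ℚ))) h ?_ κ' hκ'ker
    _ hS' _ (fun κ hκ => descent_mem_of_certs h κ hκ (![2, 7] : Fin 2 → ℕ) hps (by decide)
      ([((![1, 0], 2, 3), (4, 1, 2, 1), (1, 2, 28, Int.neg 8)),
        ((![1, 1], 2, 3), (4, 1, 2, 1), (49, 2, 196, Int.neg 56)),
        ((![1, 2], 2, 3), (4, 1, 2, 1), (2401, 2, 1372, Int.neg 392))]
        : List (((Fin 2 → Fin 3) × ℕ × ℕ) × (ℕ × ℕ × ℕ × ℕ) × (ℤ × ℤ × ℤ × ℤ)))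
      (by decide +kernel)) 1 0 0 ?_ ?_ (by norm_num)
  · exact three_nsmul_eq_zero
  · exact Finset.card_image_le.trans_lt (by decide +kernel)
  · exact Finset.card_image_le.trans_lt (by decide +kernel)

end Curve35a1Descent

/-- **`rank_ℤ 35a1(ℚ) = 0`** (Cremona, Table 1, `N = 35`, curve `A1`: `r = 0`), for the tree's model
`threeTorsionModel 4 28 = [0, 16, 0, 224, 784]` of `35a1`: the descent statement of
`KenkuLevelThirtyFiveMWReduction.lean`, PROVED by the `3`-isogeny descent above.
[cite: CremonaAlgorithms1997, Table 1, N = 35, curve A1 (r = 0)] [cite: Cohen2007NumberTheoryI, Prop. 8.4.8] -/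
theorem mordellWeilRank_35a1_eq_zero : (threeTorsionModel (4 : ℚ) 28).mordellWeilRank = 0 := by
  have h := Curve35a1Descent.model_mordellWeilRank_le_zero
  push_cast at h
  exact Nat.le_zero.mp h

/-- **The Mordell–Weil group of `35a1`** (Cremona, Table 1, `N = 35`, curve `A1`: `r = 0`, `|T| = 3`):
every rational solution of `Y² = X³ + (4X + 28)²` has `X = 0`, i.e. `35a1(ℚ) = {O, (0, ±28)} ≅ ℤ/3` —
pr-1's displayed binder `hMW` of Kenku level `35` VERBATIM, now a theorem (rank `0` by `3`-isogeny descent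
here; torsion by reduction modulo `3` and `11` in `KenkuLevelThirtyFiveMWReduction.lean`).
[cite: CremonaAlgorithms1997, Table 1, N = 35, curve A1 (r = 0, |T| = 3)] -/
theorem mordellWeil_35a1 : ∀ X Y : ℚ, Y ^ 2 = X ^ 3 + (4 * X + 28) ^ 2 → X = 0 :=
  mordellWeil_35a1_of_rank_zero mordellWeilRank_35a1_eq_zero

/-- **Kenku's printed level `35` with no displayed input left**: no elliptic curve over `ℚ` admits a
cyclic `ℚ`-isogeny of degree `35` (`Y₀(35)(ℚ) = ∅`; Kenku 1982, Thm. 1) — pr-1's level-`35` line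
(`…LevelThirtyFive*.lean`, link certificate proved there) composed with `35a1(ℚ) ≅ ℤ/3` proved here.
An INPUTS→UNCONDITIONAL library theorem; stmt-ABC-18224 itself is NOT closed by it; NOT abc.
[cite: Kenku1982, Thm. 1 and its proof, pp. 199–201] -/
theorem isCyclic_degree_ne_thirtyFive (V V' : WeierstrassCurve ℚ) [V.IsElliptic] [V'.IsElliptic]
    (ψ : Isogeny V V') (hψ : ψ.IsCyclic) : ψ.degree ≠ 35 :=
  isCyclic_degree_ne_thirtyFive_of_rank_zero mordellWeilRank_35a1_eq_zero V V' ψ hψ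

end Summit.ABC.ABC.Theorems

end
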